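import Summits.QuantumFields.YangMills.Theorems.PoincareLipschitzKuhnSphereDistance
import Summits.QuantumFields.YangMills.Theorems.PoincareLipschitzBlowDownRescale
import Summits.QuantumFields.YangMills.Theorems.PoincareLipschitzBlowDownCells
import Summits.QuantumFields.YangMills.Theorems.PoincareLipschitzLatticeTranslationPaths
import Summits.QuantumFields.YangMills.Theorems.PoincareLipschitzSamplingCells
import HarnessLib

/-!
# LINE 25 «CompactnessTransfer» (K2 crux `BlockLipschitzL` stmt-QuantumFields-23533 ∕ crux `HistoryTailL` stmt-QuantumFields-19936), S2′ infrastructure: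
# THE SEAM (E′) BETWEEN THE KUHN BLOW-DOWN (B3-a, px7 g7) AND Γ1's PIECEWISE-CONSTANT BLOW-DOWN (px3 g7) — LETTERS

Cell `ym3-torus` (YM ladder rung R3 = continuum SU(2) Yang–Mills on the three-torus — a RUNG, NOT the Clay problem: not `d = 4`, not infinite volume,
not a mass gap); width seat `ym-ust-19936-w4` gen 15, second hand to the Γ1 seat `ym3-torus-px3` g7 (seam (E′) named 2026-08-29T11:18:43Z).
THEOREMS ONLY (def-free); `--supports` the K2 crux as a helper.  Letters VERBATIM: B3-a's Kuhn hat ∕ interpolant `φ, hφ, S, u, I, hI` and blow-down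
`J x = I (c + (R + ½)•x)`, `cᵢ = zᵢ + ½` (`PoincareLipschitzKuhnBlowDown.blowDown_package`); Γ1-PC's piecewise-constant blow-down
`x ↦ u (z + ⌊R·x⌋)` on the open unit cube `Q = {|xᵢ| < 1}` (`PoincareLipschitzBlowDownL2Compactness.blowDown_L2_compact`, SIGNATURE-0 v2).

WHY.  Γ1 extracts an `L²(Q)`-limit `U` of the PIECEWISE-CONSTANT blow-downs (Kolmogorov–Riesz by name); the Γ2∕Γ4 pens work with the KUHN blow-downs
`J_k` (they carry gradients: B3-a F5∕F6∕F8).  The seam (E′) «`∫_Q ‖J_k − u_k(z_k + ⌊R_k x⌋)‖² → 0`» lets both use the SAME `U` along the SAME subsequence.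
This file holds the letters; the companion `PoincareLipschitzKuhnFloorBlowDownSeam.lean` assembles (E′) and the transfer of the limit.
* §1 ★`setIntegral_centredCube_comp_affine` — change of variables for ANY integrand, `∫_{|xᵢ|<s} G(c + R•x) = (R³)⁻¹ ∫_{cᵢ−Rs<Xᵢ<cᵢ+Rs} G` (the pattern
  of `PoincareLipschitzBlowDownRescale.integral_cube_energyDensity_rescale`); `affineBox_eq_bigBox`.
* §2 ★★`integral_bigBox_normSq_interp_sub_floor_le` — (E′-core) `∫_{bigBox z R} ‖I X − u ⌊X⌋‖² ≤ 3·E(box z (R+1))`: on each unit cube `⌊X⌋` is the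
  corner and `PoincareLipschitzKuhnSphereDistance.integral_cube_normSq_sub_le` pays the distance to the corner value by the cube's Dirichlet energy,
  summed by `PoincareLipschitzKuhnEnergy` (constant one, one boundary layer).
* §3 ★`floor_half_shift` (`⌊z + ½ + (R+½)t⌋ − z − ⌊Rt⌋ ∈ {0,1}` on `|t| < 1`), ★`sum_normSq_shift_le` (a shifted-difference sum over `[−R, R−1]³` costs
  `≤ 9×` the energy: `PoincareLipschitzLatticeTranslationPaths.sum_norm_sub_translate_sq_le` translated by `z`), ★★`integral_normSq_floorShift_le` —
  (E′-shift) `∫_Q ‖u ⌊c + (R+½)x⌋ − u (z + ⌊Rx⌋)‖² ≤ 72·(R³)⁻¹·E(box z (R+1))` via the floor cells of `PoincareLipschitzBlowDownCells`.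
HONEST: seam letters; nothing of Γ1, S2′, the organ `hImproveCoreFlat`, K1, `MeanDeviationL`, `BlockLipschitzL`, `HistoryTailL` or any rung statement is
proved.  [folklore] ([AlicandroCicalese2008] §2 piecewise-constant vs piecewise-affine interpolation of lattice fields; elementary measure theory).
-/

open scoped BigOperators Pointwise
open Literature.MathematicalPhysics.QuantumFieldTheory.Balaban1983to89 B4Eq19LatticeOperators

noncomputable section

namespace Summit.QuantumFields.YangMills.Theorems.PoincareLipschitzKuhnFloorBlowDownSeamLetters

open MeasureTheory Metric
open Summit.QuantumFields.YangMills.Theorems.PoincareLipschitzKuhnHat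
open Summit.QuantumFields.YangMills.Theorems.PoincareLipschitzKuhnInterpolant
open Summit.QuantumFields.YangMills.Theorems.PoincareLipschitzKuhnSimplexVolume
open Summit.QuantumFields.YangMills.Theorems.PoincareLipschitzKuhnPathSums
open Summit.QuantumFields.YangMills.Theorems.PoincareLipschitzKuhnEnergy
open Summit.QuantumFields.YangMills.Theorems.PoincareLipschitzKuhnSphereDistance
open Summit.QuantumFields.YangMills.Theorems.PoincareLipschitzBlowDownRescale
open Summit.QuantumFields.YangMills.Theorems.PoincareLipschitzBlowDownCells
open Summit.QuantumFields.YangMills.Theorems.PoincareLipschitzLatticeTranslationPaths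
open Summit.QuantumFields.YangMills.Theorems.PoincareLipschitzSamplingCells (absCube_subset_closedBall)

variable {E : Type*} [NormedAddCommGroup E] [NormedSpace ℝ E]
variable (φ : (Fin 3 → ℝ) → ℝ)

/-! ## §1 Change of variables: the blow-down `x ↦ c + R • x` of the centred cube onto a box costs `R⁻³` -/

omit [NormedSpace ℝ E] in
/-- **Change of variables for ANY integrand**: `∫_{|xᵢ|<s} G(c + R•x) dx = (R³)⁻¹ · ∫_{cᵢ − Rs < Xᵢ < cᵢ + Rs} G(X) dX` (`R > 0`;
Haar scaling `setIntegral_comp_smul_of_pos` + translation invariance through indicators, the pattern of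
`PoincareLipschitzBlowDownRescale.integral_cube_energyDensity_rescale`). [folklore] -/
theorem setIntegral_centredCube_comp_affine (G : EuclideanSpace ℝ (Fin 3) → ℝ) (c : EuclideanSpace ℝ (Fin 3))
    {R : ℝ} (hR : 0 < R) (s : ℝ) :
    ∫ x in {x : EuclideanSpace ℝ (Fin 3) | ∀ i, |x i| < s}, G (c + R • x) =
      (R ^ 3)⁻¹ * ∫ X in {X : EuclideanSpace ℝ (Fin 3) | ∀ i, c i - R * s < X i ∧ X i < c i + R * s}, G X := by
  have h1 := Measure.setIntegral_comp_smul_of_pos volume (fun y => G (c + y))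
    {x : EuclideanSpace ℝ (Fin 3) | ∀ i, |x i| < s} hR
  simp only [finrank_euclideanSpace_fin, smul_eq_mul] at h1
  rw [h1, smul_centredCube hR s]
  congr 1
  rw [← integral_indicator (measurableSet_centredCube _), ← integral_indicator (measurableSet_box c R s)]
  have hind : (fun y => Set.indicator {y : EuclideanSpace ℝ (Fin 3) | ∀ i, |y i| < R * s} (fun y => G (c + y)) y) =
      fun y => Set.indicator {X : EuclideanSpace ℝ (Fin 3) | ∀ i, c i - R * s < X i ∧ X i < c i + R * s} G (c + y) := by
    funext y
    by_cases hy : y ∈ {y : EuclideanSpace ℝ (Fin 3) | ∀ i, |y i| < R * s}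
    · rw [Set.indicator_of_mem hy, Set.indicator_of_mem ((add_mem_box_iff c y R s).mpr hy)]
    · rw [Set.indicator_of_notMem hy, Set.indicator_of_notMem (fun h => hy ((add_mem_box_iff c y R s).mp h))]
  rw [hind]
  exact integral_add_left_eq_self
    (Set.indicator {X : EuclideanSpace ℝ (Fin 3) | ∀ i, c i - R * s < X i ∧ X i < c i + R * s} G) c

/-- The image box of the unit cube under `x ↦ c + (R + 1∕2) • x`, `cᵢ = zᵢ + 1∕2`, is the big box `{zᵢ − R < Xᵢ < zᵢ + R + 1}`. [folklore] -/
theorem affineBox_eq_bigBox (z : Zd 3) (R : ℤ) (c : EuclideanSpace ℝ (Fin 3)) (hc : ∀ i, c i = (z i : ℝ) + 1 / 2) :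
    {X : EuclideanSpace ℝ (Fin 3) | ∀ i, c i - ((R : ℝ) + 1 / 2) * 1 < X i ∧ X i < c i + ((R : ℝ) + 1 / 2) * 1}
      = {X : EuclideanSpace ℝ (Fin 3) | ∀ i, (z i : ℝ) - R < X i ∧ X i < z i + R + 1} := by
  ext X
  simp only [Set.mem_setOf_eq, hc, mul_one]
  constructor
  · intro h i; have := h i; constructor <;> linarith [this.1, this.2]
  · intro h i; have := h i; constructor <;> linarith [this.1, this.2]

/-! ## §2 (E′-core) The Kuhn interpolant is `L²`-close to the floor-sampled data on the big box: cell oscillation ≤ cell energy -/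

/-- On the open unit cube of corner `y`, the floor vector is `y`. [folklore] -/
theorem floorVec_eq_of_mem_cube (y : Zd 3) {x : EuclideanSpace ℝ (Fin 3)}
    (hx : x ∈ {x : EuclideanSpace ℝ (Fin 3) | ∀ i, (y i : ℝ) < x i ∧ x i < y i + 1}) :
    (fun i => ⌊x i⌋ : Zd 3) = y := by
  funext i
  exact Int.floor_eq_iff.2 ⟨(hx i).1.le, by linarith [(hx i).2]⟩

/-- ★★ **(E′-core) THE BIG-BOX CELL-OSCILLATION ROW**: for unit lattice data on `box z (R+1)` and its Kuhn interpolant `I`,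
`∫_{zᵢ − R < Xᵢ < zᵢ + R + 1} ‖I X − u ⌊X⌋‖² ≤ 3 · Σ_{w ∈ box z (R+1)} Σ_μ ‖u (w + e_μ) − u w‖²` — on each unit cube `⌊X⌋` is the corner,
and `PoincareLipschitzKuhnSphereDistance.integral_cube_normSq_sub_le` pays the distance to the corner value by the cube's Dirichlet energy,
which `PoincareLipschitzKuhnEnergy` sums to the lattice energy (constant one, one boundary layer). [folklore] -/
theorem integral_bigBox_normSq_interp_sub_floor_le
    (hφ : ∀ t, φ t = max 0 (1 + min 0 (min (t 0) (min (t 1) (t 2))) - max 0 (max (t 0) (max (t 1) (t 2)))))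
    (S : Finset (Zd 3)) (u : Zd 3 → E) (I : EuclideanSpace ℝ (Fin 3) → E)
    (hI : ∀ x, I x = ∑ w ∈ S, φ (fun i => x i - (w i : ℝ)) • u w) (hu : ∀ w, ‖u w‖ = 1)
    (z : Zd 3) (R : ℤ) (hS : ∀ w ∈ box z (R + 1), w ∈ S) :
    ∫ x in {x : EuclideanSpace ℝ (Fin 3) | ∀ i, (z i : ℝ) - R < x i ∧ x i < z i + R + 1},
        ‖I x - u (fun i => ⌊x i⌋)‖ ^ 2 ≤
      3 * ∑ w ∈ box z (R + 1), ∑ μ : Fin 3, ‖u (w + unitVec μ) - u w‖ ^ 2 := by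
  have hcorner : ∀ y ∈ box z R, ∀ v : Zd 3, (∀ i, v i = 0 ∨ v i = 1) → y + v ∈ S :=
    fun y hy v hv => hS _ (add_mem_box_succ hy hv)
  have hdisj : Set.Pairwise (↑(box z R))
      (Function.onFun Disjoint fun y : Zd 3 => {x : EuclideanSpace ℝ (Fin 3) | ∀ i, (y i : ℝ) < x i ∧ x i < y i + 1}) :=
    fun y _ y' _ hne => disjoint_cube hne
  have hcontI := continuous_interp φ hφ S u I hI
  have hcube : ∀ y ∈ box z R,
      IntegrableOn (fun x => ‖I x - u (fun i => ⌊x i⌋)‖ ^ 2)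
        {x : EuclideanSpace ℝ (Fin 3) | ∀ i, (y i : ℝ) < x i ∧ x i < y i + 1} volume ∧
      ∫ x in {x : EuclideanSpace ℝ (Fin 3) | ∀ i, (y i : ℝ) < x i ∧ x i < y i + 1}, ‖I x - u (fun i => ⌊x i⌋)‖ ^ 2 ≤
        3 * ∫ x in {x : EuclideanSpace ℝ (Fin 3) | ∀ i, (y i : ℝ) < x i ∧ x i < y i + 1},
          ∑ i : Fin 3, ‖fderiv ℝ I x (EuclideanSpace.single i (1:ℝ))‖ ^ 2 := by
    intro y hy
    have hcont2 : Continuous fun x => ‖I x - u y‖ ^ 2 := (hcontI.sub continuous_const).norm.pow 2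
    have hfin : volume {x : EuclideanSpace ℝ (Fin 3) | ∀ i, (y i : ℝ) < x i ∧ x i < y i + 1} ≠ ⊤ := by
      rw [volume_cube y]; norm_num
    have heq : Set.EqOn (fun x => ‖I x - u (fun i => ⌊x i⌋)‖ ^ 2) (fun x => ‖I x - u y‖ ^ 2)
        {x : EuclideanSpace ℝ (Fin 3) | ∀ i, (y i : ℝ) < x i ∧ x i < y i + 1} := by
      intro x hx
      simp only [floorVec_eq_of_mem_cube y hx]
    -- a crude uniform bound on the cube (unit data): `‖I x - u y‖² ≤ 36`
    have hB : ∀ x ∈ {x : EuclideanSpace ℝ (Fin 3) | ∀ i, (y i : ℝ) < x i ∧ x i < y i + 1}, ‖I x - u y‖ ^ 2 ≤ 36 := by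
      intro x hx
      obtain ⟨σ, h1, h2⟩ := exists_perm_antitone (fun i => x i - (y i : ℝ))
      obtain ⟨hS0, hS1, hS2, hS3⟩ := pathVertices_mem S y (hcorner y hy) σ
      have h0 : (y (σ 2) : ℝ) ≤ x (σ 2) := (hx (σ 2)).1.le
      have h3 : x (σ 0) ≤ (y (σ 0) : ℝ) + 1 := (hx (σ 0)).2.le
      have hle := norm_interp_sub_le φ hφ S u I hI y σ hS0 hS1 hS2 hS3 h0 h1 h2 h3
      have hd : ∀ p q : Zd 3, ‖u p - u q‖ ≤ 2 := fun p q =>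
        (norm_sub_le _ _).trans (by rw [hu, hu]; norm_num)
      have ha := hd (y + unitVec (σ 0)) y
      have hb := hd (y + unitVec (σ 0) + unitVec (σ 1)) (y + unitVec (σ 0))
      have hc := hd (y + unitVec (σ 0) + unitVec (σ 1) + unitVec (σ 2)) (y + unitVec (σ 0) + unitVec (σ 1))
      have h6 : ‖I x - u y‖ ≤ 6 := by linarith
      nlinarith [norm_nonneg (I x - u y)]
    have hint2 : IntegrableOn (fun x => ‖I x - u y‖ ^ 2)
        {x : EuclideanSpace ℝ (Fin 3) | ∀ i, (y i : ℝ) < x i ∧ x i < y i + 1} volume :=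
      Measure.integrableOn_of_bounded hfin hcont2.aestronglyMeasurable
        ((ae_restrict_iff' (measurableSet_cube y)).mpr (ae_of_all _ fun x hx => by
          rw [Real.norm_of_nonneg (by positivity)]; exact hB x hx))
    have hint1 : IntegrableOn (fun x => ‖I x - u (fun i => ⌊x i⌋)‖ ^ 2)
        {x : EuclideanSpace ℝ (Fin 3) | ∀ i, (y i : ℝ) < x i ∧ x i < y i + 1} volume :=
      hint2.congr_fun heq.symm (measurableSet_cube y)
    refine ⟨hint1, ?_⟩
    rw [setIntegral_congr_fun (measurableSet_cube y) heq]
    exact integral_cube_normSq_sub_le φ hφ S u I hI y (hcorner y hy)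
  rw [← setIntegral_congr_set (iUnion_cube_ae_eq_bigBox z R),
    integral_biUnion_finset (box z R) (fun y _ => measurableSet_cube y) hdisj (fun y hy => (hcube y hy).1)]
  calc ∑ y ∈ box z R, ∫ x in {x : EuclideanSpace ℝ (Fin 3) | ∀ i, (y i : ℝ) < x i ∧ x i < y i + 1},
          ‖I x - u (fun i => ⌊x i⌋)‖ ^ 2
      ≤ ∑ y ∈ box z R, 3 * ∫ x in {x : EuclideanSpace ℝ (Fin 3) | ∀ i, (y i : ℝ) < x i ∧ x i < y i + 1},
          ∑ i : Fin 3, ‖fderiv ℝ I x (EuclideanSpace.single i (1:ℝ))‖ ^ 2 :=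
        Finset.sum_le_sum fun y hy => (hcube y hy).2
    _ = 3 * ((1 / 6 : ℝ) * ∑ y ∈ box z R, ∑ σ : Equiv.Perm (Fin 3), (‖u (y + unitVec (σ 0)) - u y‖ ^ 2
        + ‖u (y + unitVec (σ 0) + unitVec (σ 1)) - u (y + unitVec (σ 0))‖ ^ 2
        + ‖u (y + unitVec (σ 0) + unitVec (σ 1) + unitVec (σ 2)) - u (y + unitVec (σ 0) + unitVec (σ 1))‖ ^ 2)) := by
        rw [← Finset.mul_sum, Finset.mul_sum (box z R) _ (1 / 6 : ℝ)]
        congr 1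
        exact Finset.sum_congr rfl fun y hy => integral_cube_energyDensity_eq φ hφ S u I hI y (hcorner y hy)
    _ ≤ 3 * ∑ w ∈ box z (R + 1), ∑ μ : Fin 3, ‖u (w + unitVec μ) - u w‖ ^ 2 := by
        have := sixth_sum_paths_le_bondEnergy u z R
        linarith

/-! ## §3 (E′-shift) The two samplings `⌊c + (R+½)x⌋` (Kuhn centring) and `z + ⌊Rx⌋` (Γ1's) differ by a lattice step in `{0,1}³` -/

/-- On `|t| < 1`: `⌊z + ½ + (R + ½)t⌋ − z − ⌊Rt⌋ ∈ {0, 1}` (the Kuhn blow-down's centring vs Γ1's floor sampling). [folklore] -/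
theorem floor_half_shift (zc R : ℤ) {t : ℝ} (ht : |t| < 1) :
    ⌊(zc : ℝ) + 1 / 2 + ((R : ℝ) + 1 / 2) * t⌋ - zc - ⌊(R : ℝ) * t⌋ = 0 ∨
    ⌊(zc : ℝ) + 1 / 2 + ((R : ℝ) + 1 / 2) * t⌋ - zc - ⌊(R : ℝ) * t⌋ = 1 := by
  have h1 := Int.floor_le ((R : ℝ) * t)
  have h2 := Int.lt_floor_add_one ((R : ℝ) * t)
  rw [abs_lt] at ht
  have hlo : zc + ⌊(R : ℝ) * t⌋ ≤ ⌊(zc : ℝ) + 1 / 2 + ((R : ℝ) + 1 / 2) * t⌋ :=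
    Int.le_floor.2 (by push_cast; linarith)
  have hhi : ⌊(zc : ℝ) + 1 / 2 + ((R : ℝ) + 1 / 2) * t⌋ < zc + ⌊(R : ℝ) * t⌋ + 2 :=
    Int.floor_lt.2 (by push_cast; linarith)
  omega

omit [NormedSpace ℝ E] in
/-- **The shifted-difference sum is paid by the lattice energy**: for a lattice step `s ∈ {0,1}³`,
`Σ_{y ∈ [−R, R−1]³} ‖u (z + y + s) − u (z + y)‖² ≤ 9 · Σ_{w ∈ box z (R+1)} Σ_μ ‖u (w + e_μ) − u w‖²`
(`PoincareLipschitzLatticeTranslationPaths.sum_norm_sub_translate_sq_le` on the cube `[−R, R]³`, translated by `z`). [folklore] -/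
theorem sum_normSq_shift_le (u : Zd 3 → E) (z : Zd 3) (R : ℤ) (s : Zd 3)
    (hs : ∀ i, s i = 0 ∨ s i = 1) :
    ∑ y ∈ Fintype.piFinset (fun _ : Fin 3 => Finset.Icc (-R) (R - 1)), ‖u (z + y + s) - u (z + y)‖ ^ 2 ≤
      9 * ∑ w ∈ box z (R + 1), ∑ μ : Fin 3, ‖u (w + unitVec μ) - u w‖ ^ 2 := by
  classical
  set u' : Zd 3 → E := fun p => u (z + p) with hu'
  -- reindex `y ↦ a := y + s` into the slab `A_s` of the translation lemma
  have hinj : Set.InjOn (fun y : Zd 3 => y + s) ↑(Fintype.piFinset (fun _ : Fin 3 => Finset.Icc (-R) (R - 1))) :=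
    fun y _ y' _ h => add_right_cancel h
  have hsub : (Fintype.piFinset (fun _ : Fin 3 => Finset.Icc (-R) (R - 1))).image (fun y : Zd 3 => y + s) ⊆
      Fintype.piFinset (fun i : Fin 3 => Finset.Icc (max (-R) (-R + s i)) (min R (R + s i))) := by
    intro a ha
    rw [Finset.mem_image] at ha
    obtain ⟨y, hy, rfl⟩ := ha
    rw [Fintype.mem_piFinset] at hy ⊢
    intro i
    have hyi := Finset.mem_Icc.1 (hy i)
    rw [Finset.mem_Icc]
    rcases hs i with h | h <;> simp only [Pi.add_apply, h] <;> constructor <;> omega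
  have hstep1 : ∑ y ∈ Fintype.piFinset (fun _ : Fin 3 => Finset.Icc (-R) (R - 1)), ‖u (z + y + s) - u (z + y)‖ ^ 2
      = ∑ a ∈ (Fintype.piFinset (fun _ : Fin 3 => Finset.Icc (-R) (R - 1))).image (fun y : Zd 3 => y + s),
          ‖u' a - u' (a - s)‖ ^ 2 := by
    rw [Finset.sum_image hinj]
    refine Finset.sum_congr rfl fun y _ => ?_
    simp only [hu', add_sub_cancel_right, add_assoc]
  have hstep2 : ∑ a ∈ (Fintype.piFinset (fun _ : Fin 3 => Finset.Icc (-R) (R - 1))).image (fun y : Zd 3 => y + s),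
          ‖u' a - u' (a - s)‖ ^ 2
      ≤ ∑ a ∈ Fintype.piFinset (fun i : Fin 3 => Finset.Icc (max (-R) (-R + s i)) (min R (R + s i))),
          ‖u' a - u' (a - s)‖ ^ 2 :=
    Finset.sum_le_sum_of_subset_of_nonneg hsub fun a _ _ => by positivity
  have hstep3 := sum_norm_sub_translate_sq_le u' (-R) R s
  have hs2 : ∑ j : Fin 3, ((s j : ℤ) : ℝ) ^ 2 ≤ 3 := by
    have hj : ∀ j : Fin 3, ((s j : ℤ) : ℝ) ^ 2 ≤ 1 := fun j => by
      rcases hs j with h | h <;> simp [h]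
    calc ∑ j : Fin 3, ((s j : ℤ) : ℝ) ^ 2 ≤ ∑ _j : Fin 3, (1 : ℝ) := Finset.sum_le_sum fun j _ => hj j
      _ = 3 := by simp
  -- the energy of `u'` on `[−R, R]³` is at most the energy of `u` on `box z (R+1)`
  have hinj2 : Set.InjOn (fun p : Zd 3 => z + p) ↑(Fintype.piFinset (fun _ : Fin 3 => Finset.Icc (-R) R)) :=
    fun p _ p' _ h => add_left_cancel h
  have hsub2 : (Fintype.piFinset (fun _ : Fin 3 => Finset.Icc (-R) R)).image (fun p : Zd 3 => z + p) ⊆ box z (R + 1) := by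
    intro w hw
    rw [Finset.mem_image] at hw
    obtain ⟨p, hp, rfl⟩ := hw
    rw [Fintype.mem_piFinset] at hp
    rw [mem_box]
    intro i
    have hpi := Finset.mem_Icc.1 (hp i)
    simp only [Pi.add_apply, add_sub_cancel_left]
    exact abs_le.2 ⟨by omega, by omega⟩
  have hE : ∑ p ∈ Fintype.piFinset (fun _ : Fin 3 => Finset.Icc (-R) R), ∑ μ : Fin 3, ‖u' (p + unitVec μ) - u' p‖ ^ 2
      ≤ ∑ w ∈ box z (R + 1), ∑ μ : Fin 3, ‖u (w + unitVec μ) - u w‖ ^ 2 := by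
    have e1 : ∑ p ∈ Fintype.piFinset (fun _ : Fin 3 => Finset.Icc (-R) R), ∑ μ : Fin 3, ‖u' (p + unitVec μ) - u' p‖ ^ 2
        = ∑ w ∈ (Fintype.piFinset (fun _ : Fin 3 => Finset.Icc (-R) R)).image (fun p : Zd 3 => z + p),
            ∑ μ : Fin 3, ‖u (w + unitVec μ) - u w‖ ^ 2 := by
      rw [Finset.sum_image hinj2]
      refine Finset.sum_congr rfl fun p _ => ?_
      simp only [hu', add_assoc]
    rw [e1]
    exact Finset.sum_le_sum_of_subset_of_nonneg hsub2 fun w _ _ => Finset.sum_nonneg fun μ _ => by positivity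
  have hE0 : 0 ≤ ∑ p ∈ Fintype.piFinset (fun _ : Fin 3 => Finset.Icc (-R) R), ∑ μ : Fin 3, ‖u' (p + unitVec μ) - u' p‖ ^ 2 :=
    Finset.sum_nonneg fun p _ => Finset.sum_nonneg fun μ _ => by positivity
  calc ∑ y ∈ Fintype.piFinset (fun _ : Fin 3 => Finset.Icc (-R) (R - 1)), ‖u (z + y + s) - u (z + y)‖ ^ 2
      ≤ 3 * (∑ j : Fin 3, ((s j : ℤ) : ℝ) ^ 2) *
          ∑ p ∈ Fintype.piFinset (fun _ : Fin 3 => Finset.Icc (-R) R), ∑ μ : Fin 3, ‖u' (p + unitVec μ) - u' p‖ ^ 2 := by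
        rw [hstep1]; exact hstep2.trans hstep3
    _ ≤ 3 * 3 * ∑ p ∈ Fintype.piFinset (fun _ : Fin 3 => Finset.Icc (-R) R), ∑ μ : Fin 3, ‖u' (p + unitVec μ) - u' p‖ ^ 2 := by
        have := mul_le_mul_of_nonneg_right hs2 hE0
        nlinarith
    _ ≤ 9 * ∑ w ∈ box z (R + 1), ∑ μ : Fin 3, ‖u (w + unitVec μ) - u w‖ ^ 2 := by linarith

/-- The open unit cube `{|xᵢ| < 1}` has finite volume. [folklore] -/
theorem volume_unitCube_lt_top : volume {x : EuclideanSpace ℝ (Fin 3) | ∀ i, |x i| < 1} < ⊤ := by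
  have hsub : {x : EuclideanSpace ℝ (Fin 3) | ∀ i, |x i| < 1} ⊆ closedBall (0 : EuclideanSpace ℝ (Fin 3)) (2 * 1) := by
    intro x hx
    exact absCube_subset_closedBall zero_le_one (fun i => (hx i).le)
  exact (measure_mono hsub).trans_lt measure_closedBall_lt_top

/-- The blow-down sampling `x ↦ u ⌊c + R' • x⌋` of a lattice map into `ℝ⁴` is measurable. [folklore] -/
theorem measurable_comp_floor_affine (u : Zd 3 → EuclideanSpace ℝ (Fin 4)) (c : EuclideanSpace ℝ (Fin 3)) (R' : ℝ) :
    Measurable fun x : EuclideanSpace ℝ (Fin 3) => u (fun i => ⌊(c + R' • x) i⌋) := by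
  refine (measurable_of_countable u).comp (measurable_pi_iff.2 fun i => Int.measurable_floor.comp ?_)
  exact (measurable_coord i).comp ((measurable_id.const_smul R').const_add c)

/-- ★★ **(E′-shift) THE SAMPLING-SHIFT ROW**: for unit `u : ℤ³ → S³ ⊂ ℝ⁴`, `R ≥ 1`, `cᵢ = zᵢ + ½`:
`∫_{|xᵢ|<1} ‖u ⌊c + (R+½)x⌋ − u (z + ⌊Rx⌋)‖² ≤ 72 · (R³)⁻¹ · Σ_{w ∈ box z (R+1)} Σ_μ ‖u (w + e_μ) − u w‖²` — on the floor cell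
`{⌊Rx⌋ = y}` the two samplings differ by a step `s ∈ {0,1}³` (`floor_half_shift`), the cell has volume `R⁻³`
(`PoincareLipschitzBlowDownCells.setIntegral_comp_floorVec_le_sum`), and each of the `8` shifted-difference sums costs `≤ 9×` the energy
(`sum_normSq_shift_le`). [folklore] -/
theorem integral_normSq_floorShift_le (u : Zd 3 → EuclideanSpace ℝ (Fin 4)) (hu : ∀ w, ‖u w‖ = 1)
    (z : Zd 3) (R : ℤ) (hR : 1 ≤ R) (c : EuclideanSpace ℝ (Fin 3)) (hc : ∀ i, c i = (z i : ℝ) + 1 / 2) :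
    ∫ x in {x : EuclideanSpace ℝ (Fin 3) | ∀ i, |x i| < 1},
        ‖u (fun i => ⌊(c + ((R : ℝ) + 1 / 2) • x) i⌋) - u (z + fun i => ⌊(R : ℝ) * x i⌋)‖ ^ 2 ≤
      72 * ((R : ℝ) ^ 3)⁻¹ * ∑ w ∈ box z (R + 1), ∑ μ : Fin 3, ‖u (w + unitVec μ) - u w‖ ^ 2 := by
  classical
  have hR0 : (0 : ℝ) < R := by exact_mod_cast (by omega : (0 : ℤ) < R)
  set Ssh : Finset (Zd 3) := Fintype.piFinset (fun _ : Fin 3 => ({0, 1} : Finset ℤ)) with hSsh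
  set G : Zd 3 → ℝ := fun y => ∑ s ∈ Ssh, ‖u (z + y + s) - u (z + y)‖ ^ 2 with hG
  have hG0 : ∀ y, 0 ≤ G y := fun y => Finset.sum_nonneg fun s _ => by positivity
  -- pointwise domination on the cube by `G ⌊Rx⌋`
  have hptw : ∀ x ∈ {x : EuclideanSpace ℝ (Fin 3) | ∀ i, |x i| < 1},
      ‖u (fun i => ⌊(c + ((R : ℝ) + 1 / 2) • x) i⌋) - u (z + fun i => ⌊(R : ℝ) * x i⌋)‖ ^ 2 ≤
        G (fun i => ⌊(R : ℝ) * x i⌋) := by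
    intro x hx
    set y : Zd 3 := fun i => ⌊(R : ℝ) * x i⌋ with hy
    set s : Zd 3 := fun i => ⌊(c + ((R : ℝ) + 1 / 2) • x) i⌋ - z i - y i with hsdef
    have hcoord : ∀ i, (c + ((R : ℝ) + 1 / 2) • x) i = (z i : ℝ) + 1 / 2 + ((R : ℝ) + 1 / 2) * x i := fun i => by
      simp only [PiLp.add_apply, PiLp.smul_apply, smul_eq_mul, hc]
    have hs01 : ∀ i, s i = 0 ∨ s i = 1 := fun i => by
      have h := floor_half_shift (z i) R (hx i)
      simp only [hsdef, hy, hcoord]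
      exact h
    have hsmem : s ∈ Ssh := by
      rw [hSsh, Fintype.mem_piFinset]
      intro i
      rcases hs01 i with h | h <;> simp [h]
    have hfl : (fun i => ⌊(c + ((R : ℝ) + 1 / 2) • x) i⌋ : Zd 3) = z + y + s := by
      funext i
      simp only [hsdef, Pi.add_apply]
      ring
    rw [hfl]
    exact Finset.single_le_sum (f := fun s' => ‖u (z + y + s') - u (z + y)‖ ^ 2)
      (fun s' _ => by positivity) hsmem
  -- integrability of both sides on the cube
  have hmeasQ : MeasurableSet {x : EuclideanSpace ℝ (Fin 3) | ∀ i, |x i| < 1} := measurableSet_centredCube 1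
  have hfinQ : volume {x : EuclideanSpace ℝ (Fin 3) | ∀ i, |x i| < 1} ≠ ⊤ := volume_unitCube_lt_top.ne
  have hmeas1 : Measurable fun x : EuclideanSpace ℝ (Fin 3) =>
      ‖u (fun i => ⌊(c + ((R : ℝ) + 1 / 2) • x) i⌋) - u (z + fun i => ⌊(R : ℝ) * x i⌋)‖ ^ 2 :=
    ((measurable_comp_floor_affine u c _).sub (measurable_comp_floorVec (fun y => u (z + y)) (R : ℝ))).norm.pow_const 2
  have hbd1 : ∀ x, ‖‖u (fun i => ⌊(c + ((R : ℝ) + 1 / 2) • x) i⌋) - u (z + fun i => ⌊(R : ℝ) * x i⌋)‖ ^ 2‖ ≤ 4 := by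
    intro x
    rw [Real.norm_of_nonneg (by positivity)]
    have h := norm_sub_le (u (fun i => ⌊(c + ((R : ℝ) + 1 / 2) • x) i⌋)) (u (z + fun i => ⌊(R : ℝ) * x i⌋))
    rw [hu, hu] at h
    nlinarith [norm_nonneg (u (fun i => ⌊(c + ((R : ℝ) + 1 / 2) • x) i⌋) - u (z + fun i => ⌊(R : ℝ) * x i⌋))]
  have hint1 : IntegrableOn (fun x : EuclideanSpace ℝ (Fin 3) =>
      ‖u (fun i => ⌊(c + ((R : ℝ) + 1 / 2) • x) i⌋) - u (z + fun i => ⌊(R : ℝ) * x i⌋)‖ ^ 2)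
      {x : EuclideanSpace ℝ (Fin 3) | ∀ i, |x i| < 1} volume :=
    Measure.integrableOn_of_bounded hfinQ hmeas1.aestronglyMeasurable (ae_of_all _ hbd1)
  have hGbd : ∀ y, ‖G y‖ ≤ 8 * 4 := by
    intro y
    rw [Real.norm_of_nonneg (hG0 y)]
    have hterm : ∀ s ∈ Ssh, ‖u (z + y + s) - u (z + y)‖ ^ 2 ≤ 4 := by
      intro s _
      have h := norm_sub_le (u (z + y + s)) (u (z + y))
      rw [hu, hu] at h
      nlinarith [norm_nonneg (u (z + y + s) - u (z + y))]
    have hcard : Ssh.card = 8 := by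
      rw [hSsh, Fintype.card_piFinset]
      simp
    calc G y = ∑ s ∈ Ssh, ‖u (z + y + s) - u (z + y)‖ ^ 2 := rfl
      _ ≤ ∑ _s ∈ Ssh, (4 : ℝ) := Finset.sum_le_sum hterm
      _ = 8 * 4 := by rw [Finset.sum_const, hcard]; norm_num
  have hint2 : IntegrableOn (fun x : EuclideanSpace ℝ (Fin 3) => G (fun i => ⌊(R : ℝ) * x i⌋))
      {x : EuclideanSpace ℝ (Fin 3) | ∀ i, |x i| < 1} volume :=
    integrableOn_comp_floorVec_of_bound G (R : ℝ) hGbd volume_unitCube_lt_top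
  -- the floor image of the cube lies in `[−R, R−1]³`
  have hL : ∀ x ∈ {x : EuclideanSpace ℝ (Fin 3) | ∀ i, |x i| < 1},
      (fun i => ⌊(R : ℝ) * x i⌋ : Zd 3) ∈ Fintype.piFinset (fun _ : Fin 3 => Finset.Icc (-R) (R - 1)) := by
    intro x hx
    rw [Fintype.mem_piFinset]
    intro i
    have h := abs_lt.1 (hx i)
    rw [Finset.mem_Icc]
    constructor
    · exact Int.le_floor.2 (by push_cast; nlinarith [h.1])
    · have : ⌊(R : ℝ) * x i⌋ < R := Int.floor_lt.2 (by push_cast; nlinarith [h.2])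
      omega
  calc ∫ x in {x : EuclideanSpace ℝ (Fin 3) | ∀ i, |x i| < 1},
          ‖u (fun i => ⌊(c + ((R : ℝ) + 1 / 2) • x) i⌋) - u (z + fun i => ⌊(R : ℝ) * x i⌋)‖ ^ 2
      ≤ ∫ x in {x : EuclideanSpace ℝ (Fin 3) | ∀ i, |x i| < 1}, G (fun i => ⌊(R : ℝ) * x i⌋) :=
        setIntegral_mono_on hint1 hint2 hmeasQ hptw
    _ ≤ (R : ℝ)⁻¹ ^ 3 * ∑ y ∈ Fintype.piFinset (fun _ : Fin 3 => Finset.Icc (-R) (R - 1)), G y :=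
        setIntegral_comp_floorVec_le_sum hR0 hmeasQ _ hL G hG0
    _ = (R : ℝ)⁻¹ ^ 3 * ∑ s ∈ Ssh, ∑ y ∈ Fintype.piFinset (fun _ : Fin 3 => Finset.Icc (-R) (R - 1)),
          ‖u (z + y + s) - u (z + y)‖ ^ 2 := by
        rw [Finset.sum_comm]
    _ ≤ (R : ℝ)⁻¹ ^ 3 * ∑ _s ∈ Ssh, 9 * ∑ w ∈ box z (R + 1), ∑ μ : Fin 3, ‖u (w + unitVec μ) - u w‖ ^ 2 := by
        refine mul_le_mul_of_nonneg_left (Finset.sum_le_sum fun s hs => ?_) (by positivity)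
        have hs01 : ∀ i, s i = 0 ∨ s i = 1 := fun i => by
          rw [hSsh, Fintype.mem_piFinset] at hs
          simpa using hs i
        exact sum_normSq_shift_le u z R s hs01
    _ = 72 * ((R : ℝ) ^ 3)⁻¹ * ∑ w ∈ box z (R + 1), ∑ μ : Fin 3, ‖u (w + unitVec μ) - u w‖ ^ 2 := by
        have hcard : Ssh.card = 8 := by
          rw [hSsh, Fintype.card_piFinset]
          simp
        rw [Finset.sum_const, hcard, inv_pow]
        simp only [nsmul_eq_mul, Nat.cast_ofNat]
        ring

end Summit.QuantumFields.YangMills.Theorems.PoincareLipschitzKuhnFloorBlowDownSeamLetters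

end
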